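import Summits.Ventures.Crystal3D.Theorems.StickyWulffConstantTextureBuildCells
import HarnessLib

/-!
# The RISER PACKAGE (B6), part 1: VOCABULARY — riser frame of a box, riser / shared layers, governing ranges, hexagon prisms, the riser planes and the claim rule
# (lane T, crux `TextureLiminfV5`, stmt-Ventures-23912; design memo HOME/wulff-p2/g21/B6-DESIGN-g21.md §1; target `RiserPackage₇` of '…TextureBuildMeshV7')

HONEST FRAMING. Venture `Summits/Ventures/Crystal3D` (cell `crystal3d-full`), route `route-Ventures-StickyWulffConstant`, helper `--supports` the
law-v5 crux `TextureLiminfV5` (stmt-Ventures-23912).  DEFINITIONS by choice + their bookkeeping (census-free, standard axioms).  Nothing is proved about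
contacts or curtains here (parts 2–5); F-C1 not moved.

THE CONSTRUCTION (B6-DESIGN §1), for a v5 mesh `μ` over a risered cover `rc` and a riser box `r` (column grains `f = rtL r`, `g = rtR r`):
* `rL r, rs r, rσL r, rσR r` — the RISER FRAME: a choice from `Mesh₃.hframe r` (`S f = stacking (rL r) (rs r) (rσL r)`, `S g = stacking (rL r) (rs r) (rσR r)`,
  `rn r = rL r e₃`); `rheight r` = the height in that frame;
* `IsSharedLayer r m` — layer `m` of the two column stackings is the SAME point set (equal letters); riser layers are the others;
* `govLo r m < govHi r m` — TB-D-1's GOVERNING RANGE of a riser layer `m`: half the slab towards a riser neighbour layer, the whole slab towards a shared one;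
* `sixDir t` — the six in-plane unit directions `±u, ±v, ±(u − v)` of the triangular layer; `hexWall r c t` — the wall datum `⟪rL ν_t, x⟫ < ⟪rL ν_t, c⟫ + ½` of the
  hexagon (circumradius `1/√3`, apothem `½`) around the site `c`; `hexPrism r c m` — the hexagon prism `G_c` = six walls + the two governing faces, an `H`-polytope;
* `occF r` — the OCCUPIED `f`-sites (configuration balls on `S f`) lying in RISER layers of the frame; `riserExtra μ` — all hexagon-prism data (the riser planes);
  `riserGrain μ r T` — the CLAIM RULE: `f` if the cell's positive part contains some `G_c`, `c ∈ occF r`, else `g`;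
* `riserInput μ ct τ : TexInput rc μ` — the texture input of the riser package (certified tents `ct`, cut levels `τ`, `extra := riserExtra`, `boxGrain := riserGrain`).
Lemmas: `rframe_spec`, `norm_sixDir`, `hexWall_unit`, `hexPrism_unit`, `riserExtra_unit`, `riserGrain_mem` (the claim is one of the two column grains),
`hexPrism_subset_𝓗` (the prism data are arrangement data of the riser input).
-/

noncomputable section

open scoped BigOperators InnerProductSpace

namespace Summit.Ventures.Crystal3D.Cruxes.TextureLiminf.TexShadow

open Summit.Ventures.Crystal3D Summit.Ventures.Crystal3D.Theorems Set
open Summit.Ventures.Crystal3D.TentCertificate (height hB)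
open Literature.MathematicalPhysics.StatisticalMechanics (IsHaggSeq barlowLayer triangularVec₁ triangularVec₂)

/-! ### The six in-plane unit directions -/

/-- the six in-plane nearest-neighbour directions of the triangular layer (model frame): `u, v, v − u, −u, −v, u − v`. -/
def sixDir (t : Fin 6) : E3 :=
  ![triangularVec₁ 1, triangularVec₂ 1, triangularVec₂ 1 - triangularVec₁ 1, -triangularVec₁ 1, -triangularVec₂ 1, triangularVec₁ 1 - triangularVec₂ 1] t

/-- `‖u‖ = 1`. -/
private theorem norm_u_one : ‖(triangularVec₁ 1 : E3)‖ = 1 := by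
  rw [EuclideanSpace.norm_eq, Fin.sum_univ_three]
  simp [triangularVec₁]

/-- `‖v‖ = 1`. -/
private theorem norm_v_one : ‖(triangularVec₂ 1 : E3)‖ = 1 := by
  have h3 : Real.sqrt 3 ^ 2 = 3 := Real.sq_sqrt (by norm_num)
  have habs : |Real.sqrt 3| = Real.sqrt 3 := abs_of_nonneg (Real.sqrt_nonneg 3)
  have hsq : ‖(triangularVec₂ 1 : E3)‖ ^ 2 = 1 := by
    rw [EuclideanSpace.norm_sq_eq, Fin.sum_univ_three]
    simp [triangularVec₂, habs]
    nlinarith [h3]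
  nlinarith [norm_nonneg (triangularVec₂ 1 : E3)]

/-- `‖v − u‖ = 1`. -/
private theorem norm_v_sub_u_one : ‖(triangularVec₂ 1 - triangularVec₁ 1 : E3)‖ = 1 := by
  have h3 : Real.sqrt 3 ^ 2 = 3 := Real.sq_sqrt (by norm_num)
  have habs : |Real.sqrt 3| = Real.sqrt 3 := abs_of_nonneg (Real.sqrt_nonneg 3)
  have hsq : ‖(triangularVec₂ 1 - triangularVec₁ 1 : E3)‖ ^ 2 = 1 := by
    rw [EuclideanSpace.norm_sq_eq, Fin.sum_univ_three]
    simp [triangularVec₂, triangularVec₁, habs]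
    nlinarith [h3]
  nlinarith [norm_nonneg (triangularVec₂ 1 - triangularVec₁ 1 : E3)]

/-- The six directions are unit vectors. -/
theorem norm_sixDir (t : Fin 6) : ‖sixDir t‖ = 1 := by
  fin_cases t
  · exact norm_u_one
  · exact norm_v_one
  · exact norm_v_sub_u_one
  · show ‖-(triangularVec₁ 1 : E3)‖ = 1; rw [norm_neg]; exact norm_u_one
  · show ‖-(triangularVec₂ 1 : E3)‖ = 1; rw [norm_neg]; exact norm_v_one
  · show ‖(triangularVec₁ 1 - triangularVec₂ 1 : E3)‖ = 1; rw [← norm_neg, neg_sub]; exact norm_v_sub_u_one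

namespace Mesh₅

variable {C R₀ : ℝ} {N : ℕ} {x : Fin N → E3} {rc : RiseredCover C R₀ N x} {δ : ℝ} (μ : Mesh₅ rc δ)

/-! ### The riser frame of a box -/

/-- the frame of riser box `r` (choice from `hframe`) -/
def rL (r : Fin rc.nr) : E3 ≃ₗᵢ[ℝ] E3 := Classical.choose (μ.hframe r)

/-- the origin of riser box `r` -/
def rs (r : Fin rc.nr) : E3 := Classical.choose (Classical.choose_spec (μ.hframe r))

/-- the Hägg word of the LEFT column grain in the riser frame -/
def rσL (r : Fin rc.nr) : ℤ → ℤ := Classical.choose (Classical.choose_spec (Classical.choose_spec (μ.hframe r)))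

/-- the Hägg word of the RIGHT column grain in the riser frame -/
def rσR (r : Fin rc.nr) : ℤ → ℤ := Classical.choose (Classical.choose_spec (Classical.choose_spec (Classical.choose_spec (μ.hframe r))))

/-- **The riser frame presents both column grains and carries the piece's normal.** -/
theorem rframe_spec (r : Fin rc.nr) :
    IsHaggSeq (μ.rσL r) ∧ IsHaggSeq (μ.rσR r) ∧ rc.S (rc.rtL r) = stacking (μ.rL r) (μ.rs r) (μ.rσL r) ∧
      rc.S (rc.rtR r) = stacking (μ.rL r) (μ.rs r) (μ.rσR r) ∧ rc.rn r = μ.rL r e₃ :=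
  Classical.choose_spec (Classical.choose_spec (Classical.choose_spec (Classical.choose_spec (μ.hframe r))))

/-- height in the riser frame of box `r` -/
def rheight (r : Fin rc.nr) (y : E3) : ℝ := height (μ.rL r) (μ.rs r) y

/-- the layer index of a site of the riser frame (`height / hB`, an integer for sites) -/
def rlayer (r : Fin rc.nr) (c : E3) : ℤ := ⌊μ.rheight r c / hB⌋

/-! ### Riser and shared layers; governing ranges -/

/-- layer `m` of the riser frame is SHARED: the two column grains have the same sites there (equal letters); the other layers are the RISER layers -/
def IsSharedLayer (r : Fin rc.nr) (m : ℤ) : Prop := barlowLayer 1 hB (μ.rσL r) m = barlowLayer 1 hB (μ.rσR r) m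

open scoped Classical in
/-- lower end (model height) of the governing range of layer `m`: the whole slab below if layer `m − 1` is shared, half of it otherwise -/
def govLo (r : Fin rc.nr) (m : ℤ) : ℝ := if μ.IsSharedLayer r (m - 1) then ((m : ℝ) - 1) * hB else ((m : ℝ) - 1 / 2) * hB

open scoped Classical in
/-- upper end (model height) of the governing range of layer `m` -/
def govHi (r : Fin rc.nr) (m : ℤ) : ℝ := if μ.IsSharedLayer r (m + 1) then ((m : ℝ) + 1) * hB else ((m : ℝ) + 1 / 2) * hB

/-- The governing range is a nonempty interval around the layer: `govLo < m·hB < govHi`. -/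
theorem govLo_lt_govHi (r : Fin rc.nr) (m : ℤ) : μ.govLo r m < (m : ℝ) * hB ∧ (m : ℝ) * hB < μ.govHi r m := by
  have hh := TentCertificate.hB_pos
  unfold govLo govHi
  constructor
  · split_ifs <;> nlinarith
  · split_ifs <;> nlinarith

/-- The governing range has length at most `2·hB`. -/
theorem govHi_sub_govLo_le (r : Fin rc.nr) (m : ℤ) : μ.govHi r m - μ.govLo r m ≤ 2 * hB := by
  have hh := TentCertificate.hB_pos
  unfold govLo govHi
  split_ifs <;> nlinarith

/-! ### Hexagon prisms -/

/-- the wall datum, direction `t`, of the hexagon (apothem `½`) around the site `c` of box `r`'s frame -/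
def hexWall (r : Fin rc.nr) (c : E3) (t : Fin 6) : E3 × ℝ := (μ.rL r (sixDir t), ⟪μ.rL r (sixDir t), c⟫_ℝ + 1 / 2)

/-- Hexagon walls have unit normals. -/
theorem hexWall_unit (r : Fin rc.nr) (c : E3) (t : Fin 6) : ‖(μ.hexWall r c t).1‖ = 1 := by
  simp only [hexWall, LinearIsometryEquiv.norm_map, norm_sixDir]

/-- **THE HEXAGON PRISM `G_c`** of a site `c` of layer `m` of box `r`'s frame: six walls and the two governing faces. -/
def hexPrism (r : Fin rc.nr) (c : E3) (m : ℤ) : Finset (E3 × ℝ) :=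
  Finset.univ.image (μ.hexWall r c) ∪
    {(rc.rn r, μ.govHi r m + ⟪rc.rn r, μ.rs r⟫_ℝ), (-rc.rn r, -(μ.govLo r m + ⟪rc.rn r, μ.rs r⟫_ℝ))}

/-- Hexagon-prism data have unit normals. -/
theorem hexPrism_unit (r : Fin rc.nr) (c : E3) (m : ℤ) : ∀ p ∈ μ.hexPrism r c m, ‖p.1‖ = 1 := by
  intro p hp
  simp only [hexPrism, Finset.mem_union, Finset.mem_image, Finset.mem_univ, true_and, Finset.mem_insert, Finset.mem_singleton] at hp
  rcases hp with ⟨t, rfl⟩ | rfl | rfl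
  · exact μ.hexWall_unit r c t
  · exact rc.hrn r
  · simp only [norm_neg]; exact rc.hrn r

/-! ### Occupied riser sites, the riser planes, the claim rule -/

open scoped Classical in
/-- the OCCUPIED `f`-SITES IN RISER LAYERS of box `r` (`f = rtL r`): configuration balls on `S f` whose layer in the riser frame is not shared -/
def occF (r : Fin rc.nr) : Finset E3 := rc.X'.filter fun q => q ∈ rc.S (rc.rtL r) ∧ ¬ μ.IsSharedLayer r (μ.rlayer r q)

/-- Membership in `occF`. -/
theorem mem_occF {r : Fin rc.nr} {q : E3} : q ∈ μ.occF r ↔ q ∈ rc.X' ∧ q ∈ rc.S (rc.rtL r) ∧ ¬ μ.IsSharedLayer r (μ.rlayer r q) := by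
  classical
  unfold occF; rw [Finset.mem_filter]

/-- **THE RISER PLANES** (the `extra` of the riser input): the hexagon-prism data of every occupied riser `f`-site of every box. -/
def riserExtra : Finset (E3 × ℝ) := Finset.univ.biUnion fun r => (μ.occF r).biUnion fun c => μ.hexPrism r c (μ.rlayer r c)

/-- The riser planes have unit normals. -/
theorem riserExtra_unit : ∀ p ∈ μ.riserExtra, ‖p.1‖ = 1 := by
  intro p hp
  simp only [riserExtra, Finset.mem_biUnion, Finset.mem_univ, true_and] at hp
  obtain ⟨r, c, -, hpc⟩ := hp
  exact μ.hexPrism_unit r c _ p hpc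

/-- The prism of an occupied riser site is among the riser planes. -/
theorem hexPrism_subset_riserExtra {r : Fin rc.nr} {c : E3} (hc : c ∈ μ.occF r) : μ.hexPrism r c (μ.rlayer r c) ⊆ μ.riserExtra := by
  intro p hp
  simp only [riserExtra, Finset.mem_biUnion, Finset.mem_univ, true_and]
  exact ⟨r, c, hc, hp⟩

open scoped Classical in
/-- **THE CLAIM RULE**: a cell of box `r` with positive part `T` is claimed by `f = rtL r` iff it lies in the hexagon prism of an occupied riser `f`-site
(`G_c ⊆ T`), else by `g = rtR r`. -/
def riserGrain (r : Fin rc.nr) (T : Finset (E3 × ℝ)) : Fin rc.ng :=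
  if ∃ c ∈ μ.occF r, μ.hexPrism r c (μ.rlayer r c) ⊆ T then rc.rtL r else rc.rtR r

/-- The claim is one of the two column grains. -/
theorem riserGrain_mem (r : Fin rc.nr) (T : Finset (E3 × ℝ)) : μ.riserGrain r T = rc.rtL r ∨ μ.riserGrain r T = rc.rtR r := by
  classical
  unfold riserGrain; split_ifs
  · exact Or.inl rfl
  · exact Or.inr rfl

/-- The claim is `f` exactly on the hexagon prisms of occupied riser `f`-sites. -/
theorem riserGrain_eq_rtL_iff (r : Fin rc.nr) (T : Finset (E3 × ℝ)) :
    μ.riserGrain r T = rc.rtL r ↔ ∃ c ∈ μ.occF r, μ.hexPrism r c (μ.rlayer r c) ⊆ T := by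
  classical
  unfold riserGrain
  constructor
  · intro h
    by_contra hne
    rw [if_neg hne] at h
    exact rc.hrt r h.symm
  · intro h; rw [if_pos h]

/-! ### The riser input -/

/-- **THE TEXTURE INPUT OF THE RISER PACKAGE**: certified tents `ct`, cut levels `τ`, the riser planes and the claim rule. -/
def riserInput (ct : (f : Fin rc.ng) → TentCert (rc.tent f)) (τ : Fin rc.nk → ℝ) : TexInput rc μ :=
  ⟨ct, τ, μ.riserExtra, μ.riserExtra_unit, μ.riserGrain⟩

/-- The riser planes are arrangement data of the riser input. -/
theorem riserExtra_subset_𝓗 (ct : (f : Fin rc.ng) → TentCert (rc.tent f)) (τ : Fin rc.nk → ℝ) : μ.riserExtra ⊆ (μ.riserInput ct τ).𝓗 := by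
  intro p hp
  simp only [TexInput.𝓗, Finset.mem_union]
  exact Or.inr hp

/-- The hexagon prism of an occupied riser site is cut out by arrangement data of the riser input. -/
theorem hexPrism_subset_𝓗 (ct : (f : Fin rc.ng) → TentCert (rc.tent f)) (τ : Fin rc.nk → ℝ) {r : Fin rc.nr} {c : E3} (hc : c ∈ μ.occF r) :
    μ.hexPrism r c (μ.rlayer r c) ⊆ (μ.riserInput ct τ).𝓗 :=
  (μ.hexPrism_subset_riserExtra hc).trans (μ.riserExtra_subset_𝓗 ct τ)

/-- The grain of a box cell of the riser input is one of the two column grains (the old `Good.hclaim`). -/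
theorem riserInput_boxGrain_mem (ct : (f : Fin rc.ng) → TentCert (rc.tent f)) (τ : Fin rc.nk → ℝ) (r : Fin rc.nr) (T : Finset (E3 × ℝ)) :
    (μ.riserInput ct τ).boxGrain r T = rc.rtL r ∨ (μ.riserInput ct τ).boxGrain r T = rc.rtR r :=
  μ.riserGrain_mem r T

end Mesh₅

end Summit.Ventures.Crystal3D.Cruxes.TextureLiminf.TexShadow

end
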